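import Summits.FinalStateConjecture.FinalStateConjecture.Theorems.PhotonSphereChannelsChannelsResolveTameDevelopmentsRTotalEnergyConservation
import Summits.FinalStateConjecture.FinalStateConjecture.Theorems.PhotonSphereChannelsWindowedShellChannelsStubDuality

/-!
# Crux `WindowedShellChannels` (stmt-FinalStateConjecture-14085), line `Sketch`, stub `stub_lostPSD` —
# the lost energy is a positive semidefinite quadratic form (piece S2)

The registered stub `stub_lostPSD` of line `Sketch`, over the Literature vocabulary
`ReggeWheeler.{IsSolution, IsRWSolution, totalEnergy, exteriorEnergy, channelEnergy, energyDensity,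
linePotential, tortoiseRadius}`.  For `V ≥ 0` differentiable, two global `C²` solutions `ψ₁, ψ₂` of
`ψ_tt − ψ_xx + Vψ = 0`, any centre `xc`, ANY aperture `a : ℝ` (lagged ones `a < 0` included) and
`η > 0`:

`E(ψ₁ + ψ₂) + (1 + η⁻¹)·ch_a(ψ₁) + (1 + η)·ch_a(ψ₂) ≤ ch_a(ψ₁ + ψ₂) + (1 + η⁻¹)·E(ψ₁) + (1 + η)·E(ψ₂)`

(`E` = total energy at `t = 0`, `ch_a(φ) = channelEnergy V xc a φ atTop`; all terms in `[0, ∞]`), i.e.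
the lost energy `LOST_a := E − ch_a` satisfies
`LOST_a(ψ₁ + ψ₂) ≤ (1 + η⁻¹) LOST_a(ψ₁) + (1 + η) LOST_a(ψ₂)` — it is (the diagonal of) a positive
semidefinite quadratic form, written additively so that no subtraction in `[0, ∞]` is needed.

Proof (sub-namespace `LostPSD`):

* `LostPSD.energyDensity_add_le_weighted` — pointwise `e[ψ₁ + ψ₂] ≤ (1 + η⁻¹) e[ψ₁] + (1 + η) e[ψ₂]`
  wherever `V ≥ 0` (polarisation `Duality.energyDensity_add` and `2pq ≤ η⁻¹p² + ηq²` for each of the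
  three squares), hence the same inequality for the `lintegral`s over any set
  (`LostPSD.setLIntegral_energyDensity_add_le`);
* `LostPSD.totalEnergy_add_exteriorEnergy_le_weighted` — at every time `t` the conserved total energy
  (`RW.totalEnergy_eq_totalEnergy`) is `exterior + interior` (`lintegral_add_compl` at the measurable
  exterior region `{a + |t| < |x − xc|}`); the interior part is sub-additive with the weights above,
  and adding the three exterior parts to both sides gives the fixed-time inequality
  `E(ψ₁ + ψ₂) + (1 + η⁻¹) Ext_t(ψ₁) + (1 + η) Ext_t(ψ₂) ≤ Ext_t(ψ₁ + ψ₂) + (1 + η⁻¹) E(ψ₁) + (1 + η) E(ψ₂)`;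
* `LostPSD.lostPSD` — for `t ≥ max 0 (−a)` the channel energies of `ψ₁`, `ψ₂` are at most their
  exterior energies at time `t` (`WindowedShellChannels.Negative.channelEnergy_atTop_le_exteriorEnergy`),
  so the left side is eventually at most `Ext_t(ψ₁ + ψ₂) + const`, hence at most
  `liminf_t Ext_t(ψ₁ + ψ₂) + const = ch_a(ψ₁ + ψ₂) + const` (`LostPSD.le_channelEnergy_add_of_eventually_le`).

The main theorem `stub_lostPSD` is the Regge–Wheeler instance `V = linePotential 1 s ℓ (tortoiseRadius
one_pos 0)` (`s ≤ ℓ`: `V > 0` by `RW.linePotential_pos`, differentiable by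
`RW.differentiable_linePotential`), centre `xc = 0`; the two finite-energy hypotheses of the
registered signature are not needed.  Standard material [folklore]; no new definitions; the import
closure is free of `Theses.PhotonSphereChannels`.
-/

noncomputable section

-- the tree's namespace `Summit.FinalStateConjecture.FinalStateConjecture.Theorems` repeats a component by design
-- (problem directory `Summits/FinalStateConjecture/FinalStateConjecture/…`), as in every landed file of this line
set_option linter.dupNamespace false

namespace Summit.FinalStateConjecture.FinalStateConjecture.Theorems.WindowedShellChannelsSketch

open Literature.Geometry.Lorentzian Literature.Geometry.Lorentzian.ReggeWheeler Filter Set MeasureTheory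
open Summit.FinalStateConjecture.FinalStateConjecture.Theorems.WindowedShellChannelsStubs
open scoped ENNReal Topology

namespace LostPSD

/-! ### The pointwise weighted parallelogram inequality -/

/-- Weighted AM–GM: `2pq ≤ η⁻¹p² + ηq²` for `η > 0` (`= η⁻¹(p − ηq)² ≥ 0`). [folklore] -/
theorem two_mul_le_weighted {η : ℝ} (hη : 0 < η) (p q : ℝ) :
    2 * (p * q) ≤ η⁻¹ * p ^ 2 + η * q ^ 2 := by
  have h : 0 ≤ η⁻¹ * (p - η * q) ^ 2 := mul_nonneg (inv_nonneg.2 hη.le) (sq_nonneg _)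
  have e : η⁻¹ * (p - η * q) ^ 2 = η⁻¹ * p ^ 2 + η * q ^ 2 - 2 * (p * q) := by
    field_simp
    ring
  linarith

variable {V : ℝ → ℝ} {ψ₁ ψ₂ : ℝ → ℝ → ℝ}

/-- **The energy density of a sum, weighted form**: for `C²` functions `ψ₁, ψ₂`, `η > 0` and
`V x ≥ 0`, `e[ψ₁ + ψ₂](t, x) ≤ (1 + η⁻¹) e[ψ₁](t, x) + (1 + η) e[ψ₂](t, x)` (polarisation
`e[ψ₁ + ψ₂] = e[ψ₁] + e[ψ₂] + 2(∂_tψ₁∂_tψ₂ + ∂_xψ₁∂_xψ₂ + Vψ₁ψ₂)` and `2pq ≤ η⁻¹p² + ηq²` for each of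
the three products). [folklore] -/
theorem energyDensity_add_le_weighted (hV0 : ∀ x, 0 ≤ V x)
    (h₁ : ContDiff ℝ 2 (Function.uncurry ψ₁)) (h₂ : ContDiff ℝ 2 (Function.uncurry ψ₂))
    {η : ℝ} (hη : 0 < η) (t x : ℝ) :
    energyDensity V (fun t x => ψ₁ t x + ψ₂ t x) t x
      ≤ (1 + η⁻¹) * energyDensity V ψ₁ t x + (1 + η) * energyDensity V ψ₂ t x := by
  rw [Duality.energyDensity_add h₁ h₂ t x]
  have hu := two_mul_le_weighted hη (deriv (fun τ => ψ₁ τ x) t) (deriv (fun τ => ψ₂ τ x) t)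
  have hv := two_mul_le_weighted hη (deriv (ψ₁ t) x) (deriv (ψ₂ t) x)
  have hw := mul_le_mul_of_nonneg_left (two_mul_le_weighted hη (ψ₁ t x) (ψ₂ t x)) (hV0 x)
  unfold energyDensity
  nlinarith [hu, hv, hw]

/-- The weighted inequality for the energy densities in `[0, ∞]`. [folklore] -/
theorem ofReal_energyDensity_add_le (hV0 : ∀ x, 0 ≤ V x)
    (h₁ : ContDiff ℝ 2 (Function.uncurry ψ₁)) (h₂ : ContDiff ℝ 2 (Function.uncurry ψ₂))
    {η : ℝ} (hη : 0 < η) (t x : ℝ) :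
    ENNReal.ofReal (energyDensity V (fun t x => ψ₁ t x + ψ₂ t x) t x)
      ≤ ENNReal.ofReal (1 + η⁻¹) * ENNReal.ofReal (energyDensity V ψ₁ t x)
        + ENNReal.ofReal (1 + η) * ENNReal.ofReal (energyDensity V ψ₂ t x) := by
  have hη₁ : (0 : ℝ) ≤ 1 + η⁻¹ := by positivity
  have hη₂ : (0 : ℝ) ≤ 1 + η := by positivity
  rw [← ENNReal.ofReal_mul hη₁, ← ENNReal.ofReal_mul hη₂,
    ← ENNReal.ofReal_add (mul_nonneg hη₁ (energyDensity_nonneg ψ₁ t (hV0 x)))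
      (mul_nonneg hη₂ (energyDensity_nonneg ψ₂ t (hV0 x)))]
  exact ENNReal.ofReal_le_ofReal (energyDensity_add_le_weighted hV0 h₁ h₂ hη t x)

/-- **The energy of a sum on any set, weighted form**: for `V ≥ 0` differentiable, `C²` functions
`ψ₁, ψ₂`, `η > 0`, every time `t` and every set `S`,
`∫⁻_S e[ψ₁ + ψ₂](t, ·) ≤ (1 + η⁻¹) ∫⁻_S e[ψ₁](t, ·) + (1 + η) ∫⁻_S e[ψ₂](t, ·)`. [folklore] -/
theorem setLIntegral_energyDensity_add_le (hV : Differentiable ℝ V) (hV0 : ∀ x, 0 ≤ V x)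
    (h₁ : ContDiff ℝ 2 (Function.uncurry ψ₁)) (h₂ : ContDiff ℝ 2 (Function.uncurry ψ₂))
    {η : ℝ} (hη : 0 < η) (t : ℝ) (S : Set ℝ) :
    ∫⁻ x in S, ENNReal.ofReal (energyDensity V (fun t x => ψ₁ t x + ψ₂ t x) t x)
      ≤ ENNReal.ofReal (1 + η⁻¹) * (∫⁻ x in S, ENNReal.ofReal (energyDensity V ψ₁ t x))
        + ENNReal.ofReal (1 + η) * (∫⁻ x in S, ENNReal.ofReal (energyDensity V ψ₂ t x)) := by
  have hmeas : Measurable fun x => ENNReal.ofReal (1 + η⁻¹) * ENNReal.ofReal (energyDensity V ψ₁ t x) :=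
    (ENNReal.measurable_ofReal.comp (RW.continuous_energyDensity_slice hV h₁ t).measurable).const_mul _
  calc ∫⁻ x in S, ENNReal.ofReal (energyDensity V (fun t x => ψ₁ t x + ψ₂ t x) t x)
      ≤ ∫⁻ x in S, (ENNReal.ofReal (1 + η⁻¹) * ENNReal.ofReal (energyDensity V ψ₁ t x)
          + ENNReal.ofReal (1 + η) * ENNReal.ofReal (energyDensity V ψ₂ t x)) :=
        lintegral_mono fun x => ofReal_energyDensity_add_le hV0 h₁ h₂ hη t x
    _ = _ := by
        rw [lintegral_add_left hmeas, lintegral_const_mul' _ _ ENNReal.ofReal_ne_top,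
          lintegral_const_mul' _ _ ENNReal.ofReal_ne_top]

/-! ### The fixed-time inequality and the limit `t → +∞` -/

/-- Bookkeeping in `[0, ∞]`: if the interior parts satisfy `I ≤ c₁I₁ + c₂I₂`, then
`(O + I) + c₁O₁ + c₂O₂ ≤ O + c₁(O₁ + I₁) + c₂(O₂ + I₂)`. [folklore] -/
theorem add_interior_le {O I O₁ I₁ O₂ I₂ c₁ c₂ : ℝ≥0∞} (h : I ≤ c₁ * I₁ + c₂ * I₂) :
    O + I + c₁ * O₁ + c₂ * O₂ ≤ O + c₁ * (O₁ + I₁) + c₂ * (O₂ + I₂) := by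
  calc O + I + c₁ * O₁ + c₂ * O₂ ≤ O + (c₁ * I₁ + c₂ * I₂) + c₁ * O₁ + c₂ * O₂ := by gcongr
    _ = O + c₁ * (O₁ + I₁) + c₂ * (O₂ + I₂) := by ring

/-- **The fixed-time inequality.** For `V ≥ 0` differentiable, global `C²` solutions `ψ₁, ψ₂`,
`η > 0`, any centre `xc`, aperture `a` and time `t`:
`E(ψ₁ + ψ₂) + (1 + η⁻¹) Ext_t(ψ₁) + (1 + η) Ext_t(ψ₂) ≤ Ext_t(ψ₁ + ψ₂) + (1 + η⁻¹) E(ψ₁) + (1 + η) E(ψ₂)`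
(energies at time `0`, `Ext_t = exteriorEnergy V xc a · t`): the conserved total energy is
exterior + interior at time `t`, and the interior part is sub-additive with these weights. [folklore] -/
theorem totalEnergy_add_exteriorEnergy_le_weighted (hV : Differentiable ℝ V) (hV0 : ∀ x, 0 ≤ V x)
    (hψ₁ : IsSolution V ψ₁) (hψ₂ : IsSolution V ψ₂) {η : ℝ} (hη : 0 < η) (xc a t : ℝ) :
    totalEnergy V (fun t x => ψ₁ t x + ψ₂ t x) 0
        + ENNReal.ofReal (1 + η⁻¹) * exteriorEnergy V xc a ψ₁ t
        + ENNReal.ofReal (1 + η) * exteriorEnergy V xc a ψ₂ t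
      ≤ exteriorEnergy V xc a (fun t x => ψ₁ t x + ψ₂ t x) t
        + ENNReal.ofReal (1 + η⁻¹) * totalEnergy V ψ₁ 0
        + ENNReal.ofReal (1 + η) * totalEnergy V ψ₂ 0 := by
  have hS : MeasurableSet {x : ℝ | a + |t| < |x - xc|} :=
    measurableSet_lt measurable_const (continuous_abs.comp (continuous_sub_right xc)).measurable
  have hcons : ∀ u : ℝ → ℝ → ℝ, IsSolution V u → totalEnergy V u 0
      = exteriorEnergy V xc a u t
        + ∫⁻ x in {x : ℝ | a + |t| < |x - xc|}ᶜ, ENNReal.ofReal (energyDensity V u t x) :=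
    fun u hu => by
      rw [RW.totalEnergy_eq_totalEnergy hV hV0 hu 0 t]
      unfold totalEnergy exteriorEnergy
      rw [lintegral_add_compl _ hS]
  rw [hcons _ (Duality.isSolution_add hψ₁ hψ₂), hcons ψ₁ hψ₁, hcons ψ₂ hψ₂]
  exact add_interior_le
    (setLIntegral_energyDensity_add_le hV hV0 hψ₁.1 hψ₂.1 hη t {x : ℝ | a + |t| < |x - xc|}ᶜ)

/-- Passing an eventual bound to the forward channel energy with an additive constant in `[0, ∞]`:
if `L ≤ Ext_t(φ) + K` for all late times `t`, then `L ≤ ch_a(φ) + K` (`liminf`; no finiteness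
needed — if `K = ⊤` there is nothing to prove, otherwise subtract `K`). [folklore] -/
theorem le_channelEnergy_add_of_eventually_le {xc a : ℝ} {φ : ℝ → ℝ → ℝ} {L K : ℝ≥0∞}
    (h : ∀ᶠ t in atTop, L ≤ exteriorEnergy V xc a φ t + K) :
    L ≤ channelEnergy V xc a φ atTop + K := by
  rcases eq_or_ne K ⊤ with hK | hK
  · rw [hK, add_top]
    exact le_top
  have h1 : L - K ≤ channelEnergy V xc a φ atTop :=
    le_liminf_of_le (by isBoundedDefault) (h.mono fun t ht => tsub_le_iff_right.2 ht)
  calc L ≤ L - K + K := le_tsub_add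
    _ ≤ channelEnergy V xc a φ atTop + K := by gcongr

/-- **The lost energy is a positive semidefinite quadratic form** (general potential).  For `V ≥ 0`
differentiable, global `C²` solutions `ψ₁, ψ₂`, `η > 0`, any centre `xc` and aperture `a`:
`E(ψ₁ + ψ₂) + (1 + η⁻¹) ch_a(ψ₁) + (1 + η) ch_a(ψ₂) ≤ ch_a(ψ₁ + ψ₂) + (1 + η⁻¹) E(ψ₁) + (1 + η) E(ψ₂)`
(`ch_a = channelEnergy V xc a · atTop`, energies at time `0`): for `t ≥ max 0 (−a)` the channel
energies of `ψ₁`, `ψ₂` are at most their exterior energies at time `t`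
(`WindowedShellChannels.Negative.channelEnergy_atTop_le_exteriorEnergy`), so the fixed-time inequality
bounds the left side by `Ext_t(ψ₁ + ψ₂) + const` eventually, hence by `liminf_t Ext_t(ψ₁ + ψ₂) + const`.
[folklore] -/
theorem lostPSD (hV : Differentiable ℝ V) (hV0 : ∀ x, 0 ≤ V x)
    (hψ₁ : IsSolution V ψ₁) (hψ₂ : IsSolution V ψ₂) {η : ℝ} (hη : 0 < η) (xc a : ℝ) :
    totalEnergy V (fun t x => ψ₁ t x + ψ₂ t x) 0
        + ENNReal.ofReal (1 + η⁻¹) * channelEnergy V xc a ψ₁ atTop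
        + ENNReal.ofReal (1 + η) * channelEnergy V xc a ψ₂ atTop
      ≤ channelEnergy V xc a (fun t x => ψ₁ t x + ψ₂ t x) atTop
        + ENNReal.ofReal (1 + η⁻¹) * totalEnergy V ψ₁ 0
        + ENNReal.ofReal (1 + η) * totalEnergy V ψ₂ 0 := by
  rw [add_assoc (channelEnergy V xc a (fun t x => ψ₁ t x + ψ₂ t x) atTop)]
  refine le_channelEnergy_add_of_eventually_le ?_
  filter_upwards [eventually_ge_atTop (max 0 (-a))] with t ht
  have ht0 : 0 ≤ t := le_of_max_le_left ht
  have hta : 0 ≤ a + t := by linarith [le_of_max_le_right ht]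
  calc totalEnergy V (fun t x => ψ₁ t x + ψ₂ t x) 0
        + ENNReal.ofReal (1 + η⁻¹) * channelEnergy V xc a ψ₁ atTop
        + ENNReal.ofReal (1 + η) * channelEnergy V xc a ψ₂ atTop
      ≤ totalEnergy V (fun t x => ψ₁ t x + ψ₂ t x) 0
        + ENNReal.ofReal (1 + η⁻¹) * exteriorEnergy V xc a ψ₁ t
        + ENNReal.ofReal (1 + η) * exteriorEnergy V xc a ψ₂ t := by
        gcongr
        · exact WindowedShellChannels.Negative.channelEnergy_atTop_le_exteriorEnergy hV hV0 hψ₁ xc a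
            ht0 hta
        · exact WindowedShellChannels.Negative.channelEnergy_atTop_le_exteriorEnergy hV hV0 hψ₂ xc a
            ht0 hta
    _ ≤ exteriorEnergy V xc a (fun t x => ψ₁ t x + ψ₂ t x) t
        + (ENNReal.ofReal (1 + η⁻¹) * totalEnergy V ψ₁ 0
          + ENNReal.ofReal (1 + η) * totalEnergy V ψ₂ 0) := by
        rw [← add_assoc]
        exact totalEnergy_add_exteriorEnergy_le_weighted hV hV0 hψ₁ hψ₂ hη xc a t

end LostPSD

/-- **The lost energy is a positive semidefinite quadratic form** (registered stub `stub_lostPSD`,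
piece S2 of line `Sketch`, crux stmt-FinalStateConjecture-14085).  On the centred unit-mass tortoise
line (`V = linePotential 1 s ℓ (tortoiseRadius one_pos 0) > 0`, `s ≤ ℓ`), for two global `C²`
Regge–Wheeler solutions `ψ₁, ψ₂`, every aperture `a` and `η > 0`:
`E(ψ₁ + ψ₂) + (1 + η⁻¹) ch_a(ψ₁) + (1 + η) ch_a(ψ₂) ≤ ch_a(ψ₁ + ψ₂) + (1 + η⁻¹) E(ψ₁) + (1 + η) E(ψ₂)`,
`ch_a = channelEnergy V 0 a · atTop` — i.e. `LOST_a := E − ch_a` obeys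
`LOST_a(ψ₁ + ψ₂) ≤ (1 + η⁻¹) LOST_a(ψ₁) + (1 + η) LOST_a(ψ₂)`.  Instance of `LostPSD.lostPSD`; the
finite-energy hypotheses are not used. [folklore] -/
theorem stub_lostPSD (s ℓ : ℕ) (hsℓ : s ≤ ℓ) : ∀ ψ₁ ψ₂ : ℝ → ℝ → ℝ, IsRWSolution 1 s ℓ (tortoiseRadius one_pos 0) ψ₁ → IsRWSolution 1 s ℓ (tortoiseRadius one_pos 0) ψ₂ →
    totalEnergy (linePotential 1 s ℓ (tortoiseRadius one_pos 0)) ψ₁ 0 ≠ ⊤ → totalEnergy (linePotential 1 s ℓ (tortoiseRadius one_pos 0)) ψ₂ 0 ≠ ⊤ →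
    ∀ a η : ℝ, 0 < η →
      totalEnergy (linePotential 1 s ℓ (tortoiseRadius one_pos 0)) (fun t x => ψ₁ t x + ψ₂ t x) 0
          + ENNReal.ofReal (1 + η⁻¹) * channelEnergy (linePotential 1 s ℓ (tortoiseRadius one_pos 0)) 0 a ψ₁ atTop
          + ENNReal.ofReal (1 + η) * channelEnergy (linePotential 1 s ℓ (tortoiseRadius one_pos 0)) 0 a ψ₂ atTop
        ≤ channelEnergy (linePotential 1 s ℓ (tortoiseRadius one_pos 0)) 0 a (fun t x => ψ₁ t x + ψ₂ t x) atTop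
          + ENNReal.ofReal (1 + η⁻¹) * totalEnergy (linePotential 1 s ℓ (tortoiseRadius one_pos 0)) ψ₁ 0
          + ENNReal.ofReal (1 + η) * totalEnergy (linePotential 1 s ℓ (tortoiseRadius one_pos 0)) ψ₂ 0 := by
  intro ψ₁ ψ₂ hψ₁ hψ₂ _ _ a η hη
  have hr : IsTortoiseRadius 1 (tortoiseRadius one_pos 0) 0 := isTortoiseRadius_tortoiseRadius one_pos 0
  exact LostPSD.lostPSD (RW.differentiable_linePotential hr s ℓ)
    (fun x => (RW.linePotential_pos hr hsℓ x).le) hψ₁ hψ₂ hη 0 a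

end Summit.FinalStateConjecture.FinalStateConjecture.Theorems.WindowedShellChannelsSketch
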